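import Mathlib

/-!
# `SnSubsetDichotomy.PolynomialSlack`, line `transport-split-hull` — the entropy certificate

Crux `Summit.MatrixMultiplication.MatrixMultiplication.Theses.SnSubsetDichotomy.PolynomialSlack`
(item `stmt-MatrixMultiplication-8306`), level-one programme on triples `S, T, U ⊆ S_n` with the
triple product property, lead c9, line `transport-split-hull`: the registered stubs
`sum_perm_prod_apply_le` and `log_density_ge_certificate` (ENTROPY CERTIFICATE, the cost engine
of the all-split endgame).

The programme measures the cost of structure in a quotient set `X ⊆ S_n` through its co-density
`K = n! / |X|`.  For a set of positions `P` (with `|P| < n`) and weights `φ k v ≥ 1` put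
`Z(π) = ∏_{k ∈ P} φ k (π k)`.  Then

* `sum_perm_prod_apply_le` — the exact uniform average behind the certificate: for `φ ≥ 0`,
  `(∑_π Z(π)) · n^{(|P|)} ≤ (∏_{k ∈ P} ∑_v φ k v) · n!`, where `n^{(r)} = n.descFactorial r`.
  Proof: group the permutations `π` by their restriction `k ↦ π k` to `P`; a non-empty class is a
  left translate of the pointwise stabiliser of `P`, which has `(n - |P|)!` elements
  (`card_filter_perm_fix_eq_factorial`, `card_filter_perm_restrict_eq_le_factorial`); dropping
  the injectivity of the restriction only adds non-negative terms, and the sum over ALL maps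
  `P → Fin n` of `∏_k φ k (f k)` is the product of the column sums (`Fintype.prod_sum`); finally
  `(n - |P|)! · n^{(|P|)} = n!` (`Nat.factorial_mul_descFactorial`).
* `log_density_ge_certificate` — for `X ≠ ∅`, `|P| < n` and `φ ≥ 1`,
  `(1/|X|) ∑_{x ∈ X} ∑_{k ∈ P} log φ k (x k)
     ≤ log (n!/|X|) + ∑_{k ∈ P} log ((∑_v φ k v)/n) + |P| · log (n/(n - |P|))`.
  Proof: Jensen for the concave `log` (`ConcaveOn.le_map_sum`, `strictConcaveOn_log_Ioi`) bounds
  the left side by `log ((1/|X|) ∑_{x ∈ X} Z(x))`; then `∑_X Z ≤ ∑_{S_n} Z` (density), the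
  uniform average above, and `(n - |P|)^{|P|} ≤ n^{(|P|)}` (`Nat.pow_sub_le_descFactorial`).

With `φ k v = λ_α` on the level block `J_α` of position `k` and `1` elsewhere the second item reads
`log K ≥ ∑_α P_X(E_α) log λ_α − ∑_α log (1 + (λ_α - 1)|J_α|/n) − |P| log (n/(n-|P|))`, an
entropy bound subsuming all `m`-fold cylinder costs of the family `(E_α)`.  Mathlib only.
-/

-- `Summit.<Summit>.<Problem>` is the tree's mandated summit-side namespace; for this
-- single-conjunct summit the two coincide, so the file silences `dupNamespace`.
set_option linter.dupNamespace false

open scoped BigOperators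

namespace Summit.MatrixMultiplication.MatrixMultiplication.Theorems.PolynomialSlack

/-- **Pointwise stabiliser of a set of positions.** For `P ⊆ Fin n`, exactly `(n - |P|)!`
permutations `σ` of `Fin n` fix every point of `P`: they correspond to the permutations of the
complement `{a // a ∉ P}` (`Equiv.Perm.subtypeEquivSubtypePerm`), a type with `n - |P|` elements.
[folklore] -/
theorem card_filter_perm_fix_eq_factorial {n : ℕ} (P : Finset (Fin n)) :
    (Finset.univ.filter fun σ : Equiv.Perm (Fin n) => ∀ a ∈ P, σ a = a).card =
      (n - P.card).factorial := by
  classical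
  have e : {σ : Equiv.Perm (Fin n) // ∀ a ∈ P, σ a = a} ≃ Equiv.Perm {a : Fin n // a ∉ P} :=
    (Equiv.subtypeEquivRight fun σ => by simp only [not_not]).trans
      (Equiv.Perm.subtypeEquivSubtypePerm fun a : Fin n => a ∉ P).symm
  have h := Fintype.card_congr e
  rw [Fintype.card_perm, Fintype.card_subtype_compl, Fintype.card_fin, Fintype.card_coe,
    Fintype.card_subtype] at h
  exact h

/-- **Permutations with prescribed values on a set of positions.** For `P ⊆ Fin n` and any
assignment `b : P → Fin n`, at most `(n - |P|)!` permutations `π` of `Fin n` satisfy `π k = b k`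
for all `k ∈ P`: if `π₀` is one of them, `π ↦ π₀⁻¹ π` maps them injectively into the pointwise
stabiliser of `P` (`card_filter_perm_fix_eq_factorial`); if there is none the count is `0`.
(Equality holds exactly when `b` is injective; only the bound is needed here.) [folklore] -/
theorem card_filter_perm_restrict_eq_le_factorial {n : ℕ} (P : Finset (Fin n))
    (b : ↥P → Fin n) :
    (Finset.univ.filter fun π : Equiv.Perm (Fin n) => (fun k : ↥P => π k) = b).card ≤
      (n - P.card).factorial := by
  classical
  rcases (Finset.univ.filter fun π : Equiv.Perm (Fin n) =>
      (fun k : ↥P => π k) = b).eq_empty_or_nonempty with hE | ⟨π₀, hπ₀⟩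
  · rw [hE, Finset.card_empty]
    exact Nat.zero_le _
  · have hπ₀b : (fun k : ↥P => π₀ k) = b := (Finset.mem_filter.1 hπ₀).2
    rw [← card_filter_perm_fix_eq_factorial P]
    refine Finset.card_le_card_of_injOn (fun π => π₀⁻¹ * π) ?_ ?_
    · intro π hπ
      have hπb : (fun k : ↥P => π k) = b := (Finset.mem_filter.1 (Finset.mem_coe.1 hπ)).2
      refine Finset.mem_coe.2 (Finset.mem_filter.2 ⟨Finset.mem_univ _, fun a ha => ?_⟩)
      rw [Equiv.Perm.mul_apply, Equiv.Perm.inv_eq_iff_eq]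
      have h1 := congrFun hπb ⟨a, ha⟩
      have h2 := congrFun hπ₀b ⟨a, ha⟩
      simp only at h1 h2
      rw [h1, h2]
    · intro π₁ _ π₂ _ h
      exact mul_left_cancel h

/-- **Uniform average of a product weight over `S_n` (entropy certificate, exact engine).**
For positions `P ⊆ Fin n` and non-negative weights `φ k v`,
`(∑_{π ∈ S_n} ∏_{k ∈ P} φ k (π k)) · n^{(|P|)} ≤ (∏_{k ∈ P} ∑_v φ k v) · n!`, where
`n^{(r)} = n (n-1) ⋯ (n-r+1) = n.descFactorial r`; i.e. the `S_n`-average of the product weight is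
at most `∏_k (∑_v φ k v) / n^{(|P|)}`, the value it would have if the restriction `π|_P` were a
uniformly random INJECTIVE map, bounded by the sum over ALL maps `P → Fin n`.  Proof: group `π` by
its restriction to `P` (classes of size `≤ (n - |P|)!`,
`card_filter_perm_restrict_eq_le_factorial`), bound the sum over restrictions by the sum over all
maps (`Fintype.prod_sum`: `∑_f ∏_k φ k (f k) = ∏_k ∑_v φ k v`), and use
`(n - |P|)! · n^{(|P|)} = n!`; for `n < |P|` the left side is `0`. [folklore] -/
theorem sum_perm_prod_apply_le {n : ℕ} (P : Finset (Fin n)) (φ : Fin n → Fin n → ℝ)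
    (hφ : ∀ k v, 0 ≤ φ k v) :
    (∑ π : Equiv.Perm (Fin n), ∏ k ∈ P, φ k (π k)) * (n.descFactorial P.card : ℝ) ≤
      (∏ k ∈ P, ∑ v : Fin n, φ k v) * (n.factorial : ℝ) := by
  classical
  rcases Nat.lt_or_ge n P.card with hlt | hle
  · -- degenerate case (cannot happen for `P ⊆ Fin n`, but it is cheaper to treat than to exclude)
    rw [Nat.descFactorial_eq_zero_iff_lt.2 hlt, Nat.cast_zero, mul_zero]
    exact mul_nonneg (Finset.prod_nonneg fun k _ => Finset.sum_nonneg fun v _ => hφ k v)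
      (Nat.cast_nonneg _)
  · -- the weight as a function of the restriction `f = π|_P : ↥P → Fin n`
    set g : (↥P → Fin n) → ℝ := fun f => ∏ k : ↥P, φ k (f k)
    have hg0 : ∀ f, 0 ≤ g f := fun f => Finset.prod_nonneg fun k _ => hφ _ _
    have h1 : ∑ π : Equiv.Perm (Fin n), ∏ k ∈ P, φ k (π k)
        = ∑ π : Equiv.Perm (Fin n), g (fun k : ↥P => π k) := by
      refine Finset.sum_congr rfl fun π _ => ?_
      exact (Finset.prod_coe_sort P (fun k => φ k (π k))).symm
    -- group the permutations by their restriction to `P`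
    have h2 : ∑ π : Equiv.Perm (Fin n), g (fun k : ↥P => π k)
        = ∑ b : ↥P → Fin n, ((Finset.univ.filter fun π : Equiv.Perm (Fin n) =>
            (fun k : ↥P => π k) = b).card : ℝ) * g b := by
      rw [← Finset.sum_fiberwise' Finset.univ
        (fun π : Equiv.Perm (Fin n) => fun k : ↥P => π k) g]
      simp only [Finset.sum_const, nsmul_eq_mul]
    -- each class has at most `(n - |P|)!` elements
    have h3 : ∑ b : ↥P → Fin n, ((Finset.univ.filter fun π : Equiv.Perm (Fin n) =>
            (fun k : ↥P => π k) = b).card : ℝ) * g b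
        ≤ ∑ b : ↥P → Fin n, ((n - P.card).factorial : ℝ) * g b :=
      Finset.sum_le_sum fun b _ => mul_le_mul_of_nonneg_right
        (by exact_mod_cast card_filter_perm_restrict_eq_le_factorial P b) (hg0 b)
    -- the sum over ALL maps of the product weight is the product of the column sums
    have h4 : ∑ b : ↥P → Fin n, ((n - P.card).factorial : ℝ) * g b
        = ((n - P.card).factorial : ℝ) * ∏ k ∈ P, ∑ v : Fin n, φ k v := by
      rw [← Finset.mul_sum, ← Finset.prod_coe_sort P, Fintype.prod_sum]
    have h5 : ((n - P.card).factorial : ℝ) * (n.descFactorial P.card : ℝ) = (n.factorial : ℝ) := by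
      exact_mod_cast Nat.factorial_mul_descFactorial hle
    calc (∑ π : Equiv.Perm (Fin n), ∏ k ∈ P, φ k (π k)) * (n.descFactorial P.card : ℝ)
        ≤ (((n - P.card).factorial : ℝ) * ∏ k ∈ P, ∑ v : Fin n, φ k v) *
            (n.descFactorial P.card : ℝ) := by
          refine mul_le_mul_of_nonneg_right ?_ (Nat.cast_nonneg _)
          rw [h1, h2]
          exact h3.trans h4.le
      _ = (∏ k ∈ P, ∑ v : Fin n, φ k v) * (n.factorial : ℝ) := by
          rw [← h5]
          ring

/-- **Entropy certificate for the co-density of a subset of `S_n`.** Let `X ⊆ S_n` be non-empty,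
`P ⊆ Fin n` a set of positions with `|P| < n`, and `φ k v ≥ 1` weights.  Then
`(1/|X|) ∑_{x ∈ X} ∑_{k ∈ P} log φ k (x k)
   ≤ log (n!/|X|) + ∑_{k ∈ P} log ((∑_v φ k v)/n) + |P| · log (n/(n - |P|))`.
Proof: with `Z(π) = ∏_{k ∈ P} φ k (π k) ≥ 1`, the left side is the `X`-average of `log Z`, at most
`log` of the `X`-average of `Z` (Jensen, `log` concave on `(0, ∞)`); the `X`-sum of `Z` is at most
its `S_n`-sum (density, factor `n!/|X|`), which `sum_perm_prod_apply_le` bounds by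
`(∏_k ∑_v φ k v) · n!/n^{(|P|)}`; finally `n^{(|P|)} ≥ (n - |P|)^{|P|}`
(`Nat.pow_sub_le_descFactorial`) and `∏_k (∑_v φ k v) / n^{|P|} = ∏_k ((∑_v φ k v)/n)`.
In the programme (`X = T⁻¹U`, `φ k · = λ_α ≥ 1` on the level block `J_α` of position `k` and `1`
elsewhere) this is the certificate `log K ≥ ∑_α P_X(E_α) log λ_α − ∑_α log (1 + (λ_α-1)|J_α|/n) −
|P| log (n/(n-|P|))` for the co-density `K = n!/|X|`. [folklore] -/
theorem log_density_ge_certificate {n : ℕ} (X : Finset (Equiv.Perm (Fin n))) (hX : X.Nonempty)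
    (P : Finset (Fin n)) (hP : P.card < n) (φ : Fin n → Fin n → ℝ) (hφ : ∀ k v, 1 ≤ φ k v) :
    (∑ x ∈ X, ∑ k ∈ P, Real.log (φ k (x k))) / X.card ≤
      Real.log ((n.factorial : ℝ) / X.card) + ∑ k ∈ P, Real.log ((∑ v : Fin n, φ k v) / n) +
        P.card * Real.log ((n : ℝ) / (n - P.card)) := by
  classical
  -- positivity bookkeeping
  have hφ0 : ∀ k v, 0 < φ k v := fun k v => one_pos.trans_le (hφ k v)
  have hnR : (0 : ℝ) < n := Nat.cast_pos.2 (lt_of_le_of_lt (Nat.zero_le _) hP)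
  have hXc : (0 : ℝ) < X.card := Nat.cast_pos.2 hX.card_pos
  have hnr : (0 : ℝ) < (n : ℝ) - P.card := by
    rw [sub_pos]
    exact_mod_cast hP
  have hfac : (0 : ℝ) < n.factorial := Nat.cast_pos.2 n.factorial_pos
  -- the weight `Z π = ∏_{k ∈ P} φ k (π k) > 0` and the column sums `S k = ∑_v φ k v ≥ n > 0`
  set Z : Equiv.Perm (Fin n) → ℝ := fun π => ∏ k ∈ P, φ k (π k)
  have hZpos : ∀ π, 0 < Z π := fun π => Finset.prod_pos fun k _ => hφ0 k (π k)
  set S : Fin n → ℝ := fun k => ∑ v, φ k v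
  have hSpos : ∀ k, 0 < S k := fun k => by
    refine hnR.trans_le ?_
    have h := Finset.card_nsmul_le_sum Finset.univ (φ k) 1 fun v _ => hφ k v
    rwa [Finset.card_univ, Fintype.card_fin, nsmul_eq_mul, mul_one] at h
  -- (a) the left-hand side is the `X`-average of `log Z` ...
  have hlogZ : ∀ π, Real.log (Z π) = ∑ k ∈ P, Real.log (φ k (π k)) := fun π =>
    Real.log_prod fun k _ => (hφ0 k (π k)).ne'
  have hLHS : (∑ x ∈ X, ∑ k ∈ P, Real.log (φ k (x k))) / X.card =
      ∑ x ∈ X, (X.card : ℝ)⁻¹ • Real.log (Z x) := by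
    rw [div_eq_inv_mul, Finset.mul_sum]
    simp only [smul_eq_mul, hlogZ]
  -- ... which Jensen (the concavity of `log` on `(0, ∞)`) bounds by `log` of the average of `Z`
  have hJ : ∑ x ∈ X, (X.card : ℝ)⁻¹ • Real.log (Z x) ≤
      Real.log (∑ x ∈ X, (X.card : ℝ)⁻¹ • Z x) :=
    strictConcaveOn_log_Ioi.concaveOn.le_map_sum (fun _ _ => inv_nonneg.2 hXc.le)
      (by rw [Finset.sum_const, nsmul_eq_mul, mul_inv_cancel₀ hXc.ne']) fun x _ => hZpos x
  have hApos : 0 < ∑ x ∈ X, (X.card : ℝ)⁻¹ • Z x := by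
    rw [← Finset.smul_sum, smul_eq_mul]
    exact mul_pos (inv_pos.2 hXc) (Finset.sum_pos (fun π _ => hZpos π) hX)
  -- (b) density `∑_X Z ≤ ∑_{S_n} Z`, (c) the uniform average, and `(n - |P|)^|P| ≤ n^(|P|)`
  have hsumX : ∑ x ∈ X, Z x ≤ ∑ π, Z π :=
    Finset.sum_le_univ_sum_of_nonneg fun π => (hZpos π).le
  have hdesc : ((n : ℝ) - P.card) ^ P.card ≤ (n.descFactorial P.card : ℝ) := by
    have h := (Nat.pow_le_pow_left (Nat.sub_le_sub_right n.le_succ P.card) P.card).trans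
      (Nat.pow_sub_le_descFactorial n P.card)
    rw [← show ((n - P.card : ℕ) : ℝ) = (n : ℝ) - P.card from Nat.cast_sub hP.le]
    exact_mod_cast h
  have hkey : (∑ x ∈ X, Z x) * ((n : ℝ) - P.card) ^ P.card ≤ (∏ k ∈ P, S k) * n.factorial :=
    calc (∑ x ∈ X, Z x) * ((n : ℝ) - P.card) ^ P.card
        ≤ (∑ π, Z π) * (n.descFactorial P.card : ℝ) :=
          mul_le_mul hsumX hdesc (pow_nonneg hnr.le _)
            (Finset.sum_nonneg fun π _ => (hZpos π).le)
      _ ≤ (∏ k ∈ P, S k) * n.factorial := sum_perm_prod_apply_le P φ fun k v => (hφ0 k v).le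
  -- (d) the right-hand side is the `log` of one product `B`, and the average of `Z` is `≤ B`
  have hRHS : Real.log ((n.factorial : ℝ) / X.card) + ∑ k ∈ P, Real.log (S k / n) +
      P.card * Real.log ((n : ℝ) / (n - P.card)) =
        Real.log ((n.factorial : ℝ) / X.card * (∏ k ∈ P, S k / n) *
          ((n : ℝ) / (n - P.card)) ^ P.card) := by
    rw [Real.log_mul (mul_pos (div_pos hfac hXc) (Finset.prod_pos fun k _ =>
        div_pos (hSpos k) hnR)).ne' (pow_pos (div_pos hnR hnr) _).ne',
      Real.log_mul (div_pos hfac hXc).ne' (Finset.prod_pos fun k _ => div_pos (hSpos k) hnR).ne',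
      Real.log_prod fun k _ => (div_pos (hSpos k) hnR).ne', Real.log_pow]
  have hB : (n.factorial : ℝ) / X.card * (∏ k ∈ P, S k / n) * ((n : ℝ) / (n - P.card)) ^ P.card
      = (∏ k ∈ P, S k) * n.factorial / (X.card * ((n : ℝ) - P.card) ^ P.card) := by
    rw [Finset.prod_div_distrib, Finset.prod_const, div_pow]
    field_simp
  have hA : ∑ x ∈ X, (X.card : ℝ)⁻¹ • Z x =
      (∑ x ∈ X, Z x) * ((n : ℝ) - P.card) ^ P.card / (X.card * ((n : ℝ) - P.card) ^ P.card) := by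
    rw [← Finset.smul_sum, smul_eq_mul]
    field_simp
  -- assemble
  rw [hLHS, hRHS]
  refine hJ.trans (Real.log_le_log hApos ?_)
  rw [hB, hA]
  exact div_le_div_of_nonneg_right hkey (mul_pos hXc (pow_pos hnr _)).le

end Summit.MatrixMultiplication.MatrixMultiplication.Theorems.PolynomialSlack
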